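import Summits.QuantumFields.BalabanUV.Beta.GAN24.DerivativeRateTransferJensenMassFreeTransfer
import Summits.QuantumFields.BalabanUV.Beta.GAN24.DerivativeRateTransferLoewnerGramScheduleEnd

/-!
# `BalabanUV.Beta.GAN24.DerivativeRateTransferJensenMassFreeTransferWeighted` — binder row G-an2-4 ∕ (CONV-C), route R6 «VALUES, NOT DERIVATIVES», PART 90:
# THE CONVENTION TRANSFER WITH A BOND-DEPENDENT DISCREPANCY AND THE WEIGHTED-MASS END — PART 56 §2's one-token variant (`|(R″_{e′} − R′_{e′})w|² ≤ τ(e′)²|w|²`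
# bond by bond, NO size hypothesis on `τ`): the additive slack becomes `(1+s⁻¹)·⟨Qu, D_τ Qu⟩` with the DIAGONAL weight
# `D_τ(y) = w_c·Σ_{e′ : tgt′e′ = y} τ(e′)²`, i.e. (STAB-ε,δ) with the WEIGHTED carrier `G_τ = Qᵀ D_τ Q` and `δ = 1 + s⁻¹`; fed to PART 88's END the tower's
# demand collapses to ONE schedule on the column-weighted mass `|(ℋ_jᵀ G_{τ,j} ℋ_j)_{ab}| ≤ W₀·θ^{2j}` — no `Λ`, no `θ_m`, `hrate` trivial
# (unit b2b-balaban-gan24-p3, gen 47; v1 — gan24-idea-1 g64's LENS ITEM 21 ∕ REQUEST (G″) «THE END IN WEIGHTED-MASS CURRENCY», taken the hour it was posted)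

NOT IN PRINT; OUR PROOF (for the ROUTE; [folklore] finite-dimensional linear algebra over `ℝ` — PART 21's Peter–Paul, PART 53's `sum_coarseDiff_sq_le_polar`, PART 88's
`towerEnd_of_stabFamily_of_schedules`, PART 89's `polarCoeff_sub_one_le` BY NAME).  HONEST FRAMING (cell contract, verbatim): «discharging `BetaPertH` makes Bałaban's UV stability UNCONDITIONAL — a
real constructive-QFT result; it is NOT the continuum limit and NOT the Clay problem.»  HONEST DEPENDENCY (verbatim): «continuum YM on T⁴ ⇐ BetaPertH ∧ nine spine
estimates (0/9 proved); BetaPertH ⇐ (D1) ∧ (D4) ∧ CAP+tail; G-an2-4 gates asym, D1 and NE2/3/4.»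

WHY THIS FILE.  PART 56's transfer takes a UNIFORM bond letter `τ` and pays `(1+s⁻¹)·τ²·w_c·d′·⟨Qu,Qu⟩`; along the tower this forces the sup-schedule `τ_j ≤ M₀θ_m^j`
against the Gram growth `Λ` (PART 88's `hrate : θ_m²Λ ≤ θ²`).  The lens's observation (ROUTES-GAN24, gan24-idea-1 g64 LENS 21): PART 56 §2 is proved BOND BY BOND,
so a bond-dependent `τ(e′)` goes through verbatim, and PART 20 ∕ 88 quantify the carrier `G` FREELY — the tower mismatch may enter (STAB) through the weighted
carrier `Qᵀ D_τ Q`, and the END then asks only that the `D_τ`-WEIGHTED mass of the one-step block means of the unit-source minimiser columns decay like `θ^{2j}`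
(an RMS ∕ energy-currency letter — R9°'s squeeze gives two powers in RMS — instead of a sup letter of any order).

WHAT THIS FILE PROVES (0 sorry, 0 `def`, nothing cited):
* §1 `sum_coarseDiff_sq_transfer_le_weighted` (bond by bond: `Σ|R″v(tgt′) − v(src′)|² ≤ (1+s)Σ|R′v(tgt′) − v(src′)|² + (1+s⁻¹)Σ_{e′}τ(e′)²|v(tgt′e′)|²`),
  `mul_sum_bond_weight_eq` (`w_c·Σ_{e′}τ(e′)²|v(tgt′e′)|² = ⟨v, D_τ v⟩`, `D_τ = diagonal(p ↦ w_c·Σ_{tgt′e′ = p.1}τ(e′)²)`),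
  **`covJensen_transfer_weighted`** (`⟨Qu,H″_cQu⟩ ≤ (1+s)·B + (1+s⁻¹)·⟨Qu, D_τ Qu⟩` from ANY bound `B` for one connection `R′`).
* §2 **`covJensen_transfer_weighted_of_polar`** (with PART 53's `B`: `⟨Qu,H″_cQu⟩ ≤ (1+s)·c(t,r)·⟨u,H_fu⟩ + (1+s⁻¹)·⟨Qu, D_τQu⟩` for all `s, t, r > 0`),
  **`posSemidef_covJensen_transfer_weighted_of_polar`** (`0 ≤ ((1+s)c(t,r))•H_f + (1+s⁻¹)•(QᵀD_τQ) − QᵀH_cQ` — (STAB-ε,δ) with the WEIGHTED carrier).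
* §3 **`towerEnd_of_weightedMassSchedule`** (PART 88's END at `τ_j = 1`, `θ_m = 1`, `Λ = θ²`: the family `∀ s > 0, 0 ≤ ((1+s)(1+e_j))•H_{j+1} + (1+s⁻¹)•G_{j+1} − …`,
  `0 ≤ e_j ≤ E₀θ_p^j`, the WEIGHTED-MASS schedule `|(ℋ_jᵀG_jℋ_j)_{ab}| ≤ W₀·(θ²)^j`, `0 < θ ≤ 1`, `0 ≤ θ_p ≤ θ` ⟹
  `|𝒮_{j+1}(a,b) − 𝒮_j(a,b)| ≤ (cst + 2(1 + 2E₀)B + 4W₀θ²)·θ^j`), **`exists_effForm_limit_of_weightedMassSchedule`** (+ `θ < 1`: `𝒮_∞` with tail `C·θ^j∕(1−θ)`).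
* §4 **`towerEnd_of_plaquetteSchedule_of_weightedMassSchedule`** — §3 fed LITERALLY by §2's `(s,t,r)`-family + a holonomy schedule `κ_j ≤ K₀θ_p^j`
  (`t_j = K₀θ_p^j`, `r = 1` via PART 89's `polarCoeff_sub_one_le`): `≤ (cst + 2(1 + 2(5 + 8ϖ + 4ϖ′)K₀)B + 4W₀θ²)·θ^j`.
WHAT IT DOES NOT DO: bound the weighted mass `W_j` for Bałaban's tower (the lens's road: R9°'s squeeze × [CMP 99-bg] Thm 3.1 ∕ 3.3 column profile — UNTYPED);
instantiate anything of Bałaban's; touch (CONS) ∕ S2.  SUPPLIER work on route R6 (rank 2, REDUCTION, no seat); no consumer of record; NEVER «G-an2-4 closed»; NOT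
(CONV-C), NOT D1, NOT `BetaPertH`, NOT continuum, NOT Clay.  Records: `HOME/b2b-balaban-gan24-p3/WOODBURY-FIBRE.md` v14.7.
-/

noncomputable section

open Matrix Finset Filter Topology

namespace Summit.QuantumFields.BalabanUV.Beta.GAN24.DerivativeRateTransferJensenMassFreeTransferWeighted

open Literature.MathematicalPhysics.QuantumFieldTheory.Balaban1983to89.Beta.Composition (kkt)
open Literature.MathematicalPhysics.QuantumFieldTheory.Balaban1983to89.Beta.CompositionSingular (effForm minOp)
open Summit.QuantumFields.BalabanUV.Beta.GAN24.DerivativeRateTransferLoewnerKKT (mulVec_dotProduct_eq)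
open Summit.QuantumFields.BalabanUV.Beta.GAN24.DerivativeRateTransferJensenChain (dotProduct_self_add_le dotProduct_self_nonneg')
open Summit.QuantumFields.BalabanUV.Beta.GAN24.DerivativeRateTransferJensenMassFreeEnd (sum_coarseDiff_sq_le_polar)
open Summit.QuantumFields.BalabanUV.Beta.GAN24.DerivativeRateTransferLoewnerGramSchedule (towerEnd_of_stabFamily_of_schedules
  exists_effForm_limit_of_stabFamily_of_schedules)
open Summit.QuantumFields.BalabanUV.Beta.GAN24.DerivativeRateTransferLoewnerGramScheduleEnd (polarCoeff_sub_one_nonneg polarCoeff_sub_one_le)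

/-! ## §1 The transfer with a bond-dependent discrepancy and the diagonal weight -/

section Transfer

variable {o μ ν β β' : Type*} [Fintype o] [DecidableEq o] [Fintype μ] [DecidableEq μ] [Fintype ν] [Fintype β] [DecidableEq β] [Fintype β']
variable {q : μ → ν → ℝ} {W : μ → ν → Matrix o o ℝ} {Q : Matrix (μ × o) (ν × o) ℝ}
variable {src tgt : β → ν} {R : β → Matrix o o ℝ} {src' tgt' : β' → μ} {R' R'' : β' → Matrix o o ℝ}
variable {Hf : Matrix (ν × o) (ν × o) ℝ} {Hc : Matrix (μ × o) (μ × o) ℝ} {wf wc : ℝ}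
variable {σ : β' → ν ≃ ν} {ℓ : ℕ} {xs : β' → ν → ℕ → ν} {γ : β' → ν → ℕ → β} {T : β' → ν → ℕ → Matrix o o ℝ} {m : ℝ}
variable {N : β' → ν → Matrix o o ℝ} {Φ : (ν × o → ℝ) → μ → ℝ} {ϖ ϖ' κ B : ℝ} {τ : β' → ℝ}

omit [DecidableEq o] [Fintype μ] [DecidableEq μ] [Fintype ν] [Fintype β] [DecidableEq β] in
/-- **`sum_coarseDiff_sq_transfer_le_weighted`** — bond by bond Peter–Paul with a BOND-DEPENDENT discrepancy: `|(R″_{e′} − R′_{e′})w|² ≤ τ(e′)²|w|²` on every coarse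
bond ⟹ for every coarse field `v` and `s > 0`, `Σ_{e′}|R″v(tgt′) − v(src′)|² ≤ (1+s)·Σ_{e′}|R′v(tgt′) − v(src′)|² + (1+s⁻¹)·Σ_{e′}τ(e′)²|v(tgt′e′)|²`. [folklore] -/
theorem sum_coarseDiff_sq_transfer_le_weighted
    (hτ : ∀ e' (w : o → ℝ), ((R'' e' - R' e') *ᵥ w) ⬝ᵥ ((R'' e' - R' e') *ᵥ w) ≤ τ e' ^ 2 * (w ⬝ᵥ w))
    (v : μ × o → ℝ) {s : ℝ} (hs : 0 < s) :
    ∑ e', ((R'' e' *ᵥ fun a => v (tgt' e', a)) - fun a => v (src' e', a)) ⬝ᵥ ((R'' e' *ᵥ fun a => v (tgt' e', a)) - fun a => v (src' e', a)) ≤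
      (1 + s) * ∑ e', ((R' e' *ᵥ fun a => v (tgt' e', a)) - fun a => v (src' e', a)) ⬝ᵥ ((R' e' *ᵥ fun a => v (tgt' e', a)) - fun a => v (src' e', a)) +
        (1 + s⁻¹) * ∑ e', τ e' ^ 2 * ((fun a => v (tgt' e', a)) ⬝ᵥ fun a => v (tgt' e', a)) := by
  rw [Finset.mul_sum, Finset.mul_sum, ← Finset.sum_add_distrib]
  refine Finset.sum_le_sum fun e' _ => ?_
  have e : (R'' e' *ᵥ fun a => v (tgt' e', a)) - (fun a => v (src' e', a)) =
      ((R' e' *ᵥ fun a => v (tgt' e', a)) - fun a => v (src' e', a)) + (R'' e' - R' e') *ᵥ fun a => v (tgt' e', a) := by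
    rw [sub_mulVec]; abel
  rw [e]
  refine (dotProduct_self_add_le _ _ hs).trans ?_
  have hs' : (0 : ℝ) ≤ 1 + s⁻¹ := by positivity
  have h2 := mul_le_mul_of_nonneg_left (hτ e' fun a => v (tgt' e', a)) hs'
  linarith

omit [Fintype ν] [Fintype β] [DecidableEq β] in
/-- **`mul_sum_bond_weight_eq` — THE BOND-WEIGHTED SITE MASS IS A DIAGONAL FORM**: `w_c·Σ_{e′}τ(e′)²|v(tgt′e′)|² = ⟨v, D_τ v⟩` with
`D_τ = diagonal(p ↦ w_c·Σ_{e′ : tgt′e′ = p.1}τ(e′)²)`. [folklore] -/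
theorem mul_sum_bond_weight_eq (τ : β' → ℝ) (wc : ℝ) (v : μ × o → ℝ) :
    wc * ∑ e', τ e' ^ 2 * ((fun a => v (tgt' e', a)) ⬝ᵥ fun a => v (tgt' e', a)) =
      v ⬝ᵥ (Matrix.diagonal (fun p : μ × o => wc * ∑ e' ∈ Finset.univ.filter (fun e' => tgt' e' = p.1), τ e' ^ 2) *ᵥ v) := by
  -- right-hand side as a site sum
  have hR : v ⬝ᵥ (Matrix.diagonal (fun p : μ × o => wc * ∑ e' ∈ Finset.univ.filter (fun e' => tgt' e' = p.1), τ e' ^ 2) *ᵥ v) =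
      ∑ y, (wc * ∑ e' ∈ Finset.univ.filter (fun e' => tgt' e' = y), τ e' ^ 2) * ((fun a => v (y, a)) ⬝ᵥ fun a => v (y, a)) := by
    simp only [dotProduct, mulVec_diagonal, Fintype.sum_prod_type, Finset.mul_sum]
    refine Finset.sum_congr rfl fun y _ => Finset.sum_congr rfl fun a _ => ?_
    ring
  -- left-hand side fibrewise
  have hL : ∑ e', τ e' ^ 2 * ((fun a => v (tgt' e', a)) ⬝ᵥ fun a => v (tgt' e', a)) =
      ∑ y, (∑ e' ∈ Finset.univ.filter (fun e' => tgt' e' = y), τ e' ^ 2) * ((fun a => v (y, a)) ⬝ᵥ fun a => v (y, a)) := by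
    rw [← Finset.sum_fiberwise Finset.univ tgt' (fun e' => τ e' ^ 2 * ((fun a => v (tgt' e', a)) ⬝ᵥ fun a => v (tgt' e', a)))]
    refine Finset.sum_congr rfl fun y _ => ?_
    rw [Finset.sum_mul]
    refine Finset.sum_congr rfl fun e' he' => ?_
    rw [(Finset.mem_filter.mp he').2]
  rw [hR, hL, Finset.mul_sum]
  refine Finset.sum_congr rfl fun y _ => ?_
  ring

omit [Fintype β] [DecidableEq β] in
/-- **`covJensen_transfer_weighted` — ONE CONVENTION SUFFICES, WITH A BOND-DEPENDENT DISCREPANCY** [our proof]: a bound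
`w_c·Σ_{e′}|R′(Qu)(tgt′e′) − (Qu)(src′e′)|² ≤ B` for ONE coarse connection `R′`, a second connection with `|(R″_{e′} − R′_{e′})w|² ≤ τ(e′)²|w|²` bond by bond and a
coarse form `H_c ≤ w_c·Σ_{e′}|R″v(tgt′) − v(src′)|²` (`0 ≤ w_c`) ⟹ for every `s > 0`: `⟨Qu, H_cQu⟩ ≤ (1+s)·B + (1+s⁻¹)·⟨Qu, D_τ Qu⟩`. -/
theorem covJensen_transfer_weighted (hwc : 0 ≤ wc)
    (hHc : ∀ v : μ × o → ℝ, v ⬝ᵥ (Hc *ᵥ v) ≤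
      wc * ∑ e', ((R'' e' *ᵥ fun a => v (tgt' e', a)) - fun a => v (src' e', a)) ⬝ᵥ
        ((R'' e' *ᵥ fun a => v (tgt' e', a)) - fun a => v (src' e', a)))
    (hτ : ∀ e' (w : o → ℝ), ((R'' e' - R' e') *ᵥ w) ⬝ᵥ ((R'' e' - R' e') *ᵥ w) ≤ τ e' ^ 2 * (w ⬝ᵥ w))
    (u : ν × o → ℝ)
    (hB : wc * ∑ e', ((R' e' *ᵥ fun a => (Q *ᵥ u) (tgt' e', a)) - fun a => (Q *ᵥ u) (src' e', a)) ⬝ᵥ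
        ((R' e' *ᵥ fun a => (Q *ᵥ u) (tgt' e', a)) - fun a => (Q *ᵥ u) (src' e', a)) ≤ B)
    {s : ℝ} (hs : 0 < s) :
    (Q *ᵥ u) ⬝ᵥ (Hc *ᵥ (Q *ᵥ u)) ≤ (1 + s) * B +
      (1 + s⁻¹) * ((Q *ᵥ u) ⬝ᵥ (Matrix.diagonal (fun p : μ × o => wc * ∑ e' ∈ Finset.univ.filter (fun e' => tgt' e' = p.1), τ e' ^ 2) *ᵥ (Q *ᵥ u))) := by
  have h1 := sum_coarseDiff_sq_transfer_le_weighted (src' := src') (tgt' := tgt') hτ (Q *ᵥ u) hs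
  have hs' : (0 : ℝ) ≤ 1 + s⁻¹ := by positivity
  refine (hHc _).trans ?_
  refine (mul_le_mul_of_nonneg_left h1 hwc).trans ?_
  rw [← mul_sum_bond_weight_eq (tgt' := tgt') τ wc (Q *ᵥ u)]
  have h4 : wc * ((1 + s) * ∑ e', ((R' e' *ᵥ fun a => (Q *ᵥ u) (tgt' e', a)) - fun a => (Q *ᵥ u) (src' e', a)) ⬝ᵥ
      ((R' e' *ᵥ fun a => (Q *ᵥ u) (tgt' e', a)) - fun a => (Q *ᵥ u) (src' e', a))) ≤ (1 + s) * B := by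
    have : wc * ((1 + s) * ∑ e', ((R' e' *ᵥ fun a => (Q *ᵥ u) (tgt' e', a)) - fun a => (Q *ᵥ u) (src' e', a)) ⬝ᵥ
        ((R' e' *ᵥ fun a => (Q *ᵥ u) (tgt' e', a)) - fun a => (Q *ᵥ u) (src' e', a))) =
      (1 + s) * (wc * ∑ e', ((R' e' *ᵥ fun a => (Q *ᵥ u) (tgt' e', a)) - fun a => (Q *ᵥ u) (src' e', a)) ⬝ᵥ
        ((R' e' *ᵥ fun a => (Q *ᵥ u) (tgt' e', a)) - fun a => (Q *ᵥ u) (src' e', a))) := by ring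
    rw [this]
    exact mul_le_mul_of_nonneg_left hB (by linarith)
  have e3 : wc * ((1 + s⁻¹) * ∑ e', τ e' ^ 2 * ((fun a => (Q *ᵥ u) (tgt' e', a)) ⬝ᵥ fun a => (Q *ᵥ u) (tgt' e', a))) =
      (1 + s⁻¹) * (wc * ∑ e', τ e' ^ 2 * ((fun a => (Q *ᵥ u) (tgt' e', a)) ⬝ᵥ fun a => (Q *ᵥ u) (tgt' e', a))) := by ring
  rw [mul_add, e3]
  linarith [h4]

/-! ## §2 With PART 53's polar bound: (STAB-ε,δ) with the weighted carrier -/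

/-- **`covJensen_transfer_weighted_of_polar` — ONE CONVENTION SUFFICES (bond-dependent discrepancy)** [our proof]: the hypotheses of PART 53's
`sum_coarseDiff_sq_le_polar` for the POLAR connection `R′`, a second coarse connection `R″` with `|(R″_{e′} − R′_{e′})w|² ≤ τ(e′)²|w|²` on every bond and a coarse
form `H_c ≤ w_c·Σ_{e′}|R″v(tgt′) − v(src′)|²` ⟹ for all `s, t, r > 0`:
`⟨Qu, H_cQu⟩ ≤ (1+s)(1 + t + (1+t⁻¹)(1+r)ϖκ² + (1+t⁻¹)(1+r⁻¹)·3κ²(1+ϖ+ϖ′)∕(4−κ²))·⟨u,H_fu⟩ + (1+s⁻¹)·⟨Qu, D_τ Qu⟩`. -/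
theorem covJensen_transfer_weighted_of_polar
    (hq : ∀ y x, 0 ≤ q y x) (hq1 : ∀ y, ∑ x, q y x = 1) (hW : ∀ y x, (W y x)ᵀ * W y x = 1) (hR : ∀ e, (R e)ᵀ * R e = 1)
    (hR' : ∀ e', (R' e')ᵀ * R' e' = 1)
    (hQ : ∀ (u : ν × o → ℝ) (y : μ), (fun a => (Q *ᵥ u) (y, a)) = ∑ x, q y x • (W y x *ᵥ fun b => u (x, b)))
    (hwc : 0 ≤ wc)
    (hHc : ∀ v : μ × o → ℝ, v ⬝ᵥ (Hc *ᵥ v) ≤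
      wc * ∑ e', ((R'' e' *ᵥ fun a => v (tgt' e', a)) - fun a => v (src' e', a)) ⬝ᵥ
        ((R'' e' *ᵥ fun a => v (tgt' e', a)) - fun a => v (src' e', a)))
    (hτ : ∀ e' (w : o → ℝ), ((R'' e' - R' e') *ᵥ w) ⬝ᵥ ((R'' e' - R' e') *ᵥ w) ≤ τ e' ^ 2 * (w ⬝ᵥ w))
    (hHf : ∀ u : ν × o → ℝ, wf * ∑ e, ((R e *ᵥ fun b => u (tgt e, b)) - fun b => u (src e, b)) ⬝ᵥ
        ((R e *ᵥ fun b => u (tgt e, b)) - fun b => u (src e, b)) ≤ u ⬝ᵥ (Hf *ᵥ u))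
    (hσq : ∀ e' x, q (tgt' e') (σ e' x) = q (src' e') x)
    (hx0 : ∀ e' x, xs e' x 0 = x) (hxℓ : ∀ e' x, xs e' x ℓ = σ e' x)
    (hsrc : ∀ e' x i, i < ℓ → src (γ e' x i) = xs e' x i) (htgt : ∀ e' x i, i < ℓ → tgt (γ e' x i) = xs e' x (i + 1))
    (hT0 : ∀ e' x, T e' x 0 = 1) (hT : ∀ e' x i, i < ℓ → T e' x (i + 1) = T e' x i * R (γ e' x i))
    (hmult : ∀ e, ∑ e', ∑ x, ∑ i ∈ range ℓ, (if γ e' x i = e then q (src' e') x else 0) ≤ m)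
    (hw : wc * ℓ * m ≤ wf)
    (hNdef : ∀ e' x, N e' x = 1 - W (src' e') x * T e' x ℓ * (W (tgt' e') (σ e' x))ᵀ * (R' e')ᵀ)
    (hN : ∀ e' x (w : o → ℝ), (N e' x *ᵥ w) ⬝ᵥ (N e' x *ᵥ w) ≤ κ ^ 2 * (w ⬝ᵥ w))
    (hsym : ∀ e', (∑ x, q (src' e') x • N e' x)ᵀ = ∑ x, q (src' e') x • N e' x) (hκ : κ ^ 2 < 4)
    (u : ν × o → ℝ)
    (hP : ∀ y, ∑ x, q y x * (((W y x *ᵥ fun b => u (x, b)) - fun a => (Q *ᵥ u) (y, a)) ⬝ᵥ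
        ((W y x *ᵥ fun b => u (x, b)) - fun a => (Q *ᵥ u) (y, a))) ≤ Φ u y)
    (hΦ : wc * ∑ e', Φ u (tgt' e') ≤ ϖ * (u ⬝ᵥ (Hf *ᵥ u))) (hΦ' : wc * ∑ e', Φ u (src' e') ≤ ϖ' * (u ⬝ᵥ (Hf *ᵥ u)))
    {s t r : ℝ} (hs : 0 < s) (ht : 0 < t) (hr : 0 < r) :
    (Q *ᵥ u) ⬝ᵥ (Hc *ᵥ (Q *ᵥ u)) ≤
      (1 + s) * ((1 + t + (1 + t⁻¹) * (1 + r) * ϖ * κ ^ 2 + (1 + t⁻¹) * (1 + r⁻¹) * (3 * κ ^ 2 / (4 - κ ^ 2)) * (1 + ϖ + ϖ')) *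
        (u ⬝ᵥ (Hf *ᵥ u))) +
      (1 + s⁻¹) * ((Q *ᵥ u) ⬝ᵥ (Matrix.diagonal (fun p : μ × o => wc * ∑ e' ∈ Finset.univ.filter (fun e' => tgt' e' = p.1), τ e' ^ 2) *ᵥ (Q *ᵥ u))) :=
  covJensen_transfer_weighted hwc hHc hτ u
    (sum_coarseDiff_sq_le_polar hq hq1 hW hR hR' hQ hwc hHf hσq hx0 hxℓ hsrc htgt hT0 hT hmult hw hNdef hN hsym hκ u hP hΦ hΦ' ht hr) hs

/-- **`posSemidef_covJensen_transfer_weighted_of_polar` — (STAB-ε,δ) WITH THE WEIGHTED CARRIER, AS PART 88 ∕ 20 CONSUME IT** [our proof]: under the hypotheses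
of `covJensen_transfer_weighted_of_polar` for every `u`, with `H_f`, `H_c` symmetric, for all `s, t, r > 0`:
`0 ≤ ((1+s)(1 + t + (1+t⁻¹)(1+r)ϖκ² + (1+t⁻¹)(1+r⁻¹)·3κ²(1+ϖ+ϖ′)∕(4−κ²)))•H_f + (1+s⁻¹)•(Qᵀ D_τ Q) − QᵀH_cQ`. -/
theorem posSemidef_covJensen_transfer_weighted_of_polar [DecidableEq ν]
    (hq : ∀ y x, 0 ≤ q y x) (hq1 : ∀ y, ∑ x, q y x = 1) (hW : ∀ y x, (W y x)ᵀ * W y x = 1) (hR : ∀ e, (R e)ᵀ * R e = 1)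
    (hR' : ∀ e', (R' e')ᵀ * R' e' = 1)
    (hQ : ∀ (u : ν × o → ℝ) (y : μ), (fun a => (Q *ᵥ u) (y, a)) = ∑ x, q y x • (W y x *ᵥ fun b => u (x, b)))
    (hwc : 0 ≤ wc) (hHfs : Hfᵀ = Hf) (hHcs : Hcᵀ = Hc)
    (hHc : ∀ v : μ × o → ℝ, v ⬝ᵥ (Hc *ᵥ v) ≤
      wc * ∑ e', ((R'' e' *ᵥ fun a => v (tgt' e', a)) - fun a => v (src' e', a)) ⬝ᵥ
        ((R'' e' *ᵥ fun a => v (tgt' e', a)) - fun a => v (src' e', a)))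
    (hτ : ∀ e' (w : o → ℝ), ((R'' e' - R' e') *ᵥ w) ⬝ᵥ ((R'' e' - R' e') *ᵥ w) ≤ τ e' ^ 2 * (w ⬝ᵥ w))
    (hHf : ∀ u : ν × o → ℝ, wf * ∑ e, ((R e *ᵥ fun b => u (tgt e, b)) - fun b => u (src e, b)) ⬝ᵥ
        ((R e *ᵥ fun b => u (tgt e, b)) - fun b => u (src e, b)) ≤ u ⬝ᵥ (Hf *ᵥ u))
    (hσq : ∀ e' x, q (tgt' e') (σ e' x) = q (src' e') x)
    (hx0 : ∀ e' x, xs e' x 0 = x) (hxℓ : ∀ e' x, xs e' x ℓ = σ e' x)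
    (hsrc : ∀ e' x i, i < ℓ → src (γ e' x i) = xs e' x i) (htgt : ∀ e' x i, i < ℓ → tgt (γ e' x i) = xs e' x (i + 1))
    (hT0 : ∀ e' x, T e' x 0 = 1) (hT : ∀ e' x i, i < ℓ → T e' x (i + 1) = T e' x i * R (γ e' x i))
    (hmult : ∀ e, ∑ e', ∑ x, ∑ i ∈ range ℓ, (if γ e' x i = e then q (src' e') x else 0) ≤ m)
    (hw : wc * ℓ * m ≤ wf)
    (hNdef : ∀ e' x, N e' x = 1 - W (src' e') x * T e' x ℓ * (W (tgt' e') (σ e' x))ᵀ * (R' e')ᵀ)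
    (hN : ∀ e' x (w : o → ℝ), (N e' x *ᵥ w) ⬝ᵥ (N e' x *ᵥ w) ≤ κ ^ 2 * (w ⬝ᵥ w))
    (hsym : ∀ e', (∑ x, q (src' e') x • N e' x)ᵀ = ∑ x, q (src' e') x • N e' x) (hκ : κ ^ 2 < 4)
    (hP : ∀ (u : ν × o → ℝ) y, ∑ x, q y x * (((W y x *ᵥ fun b => u (x, b)) - fun a => (Q *ᵥ u) (y, a)) ⬝ᵥ
        ((W y x *ᵥ fun b => u (x, b)) - fun a => (Q *ᵥ u) (y, a))) ≤ Φ u y)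
    (hΦ : ∀ u : ν × o → ℝ, wc * ∑ e', Φ u (tgt' e') ≤ ϖ * (u ⬝ᵥ (Hf *ᵥ u)))
    (hΦ' : ∀ u : ν × o → ℝ, wc * ∑ e', Φ u (src' e') ≤ ϖ' * (u ⬝ᵥ (Hf *ᵥ u)))
    {s t r : ℝ} (hs : 0 < s) (ht : 0 < t) (hr : 0 < r) :
    (((1 + s) * (1 + t + (1 + t⁻¹) * (1 + r) * ϖ * κ ^ 2 + (1 + t⁻¹) * (1 + r⁻¹) * (3 * κ ^ 2 / (4 - κ ^ 2)) * (1 + ϖ + ϖ'))) • Hf +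
      (1 + s⁻¹) • (Qᵀ * Matrix.diagonal (fun p : μ × o => wc * ∑ e' ∈ Finset.univ.filter (fun e' => tgt' e' = p.1), τ e' ^ 2) * Q) -
        Qᵀ * Hc * Q).PosSemidef := by
  refine PosSemidef.of_dotProduct_mulVec_nonneg ?_ fun u => ?_
  · rw [Matrix.IsHermitian, Matrix.conjTranspose_eq_transpose_of_trivial, transpose_sub, transpose_add, transpose_smul, transpose_smul,
      hHfs, transpose_mul, transpose_mul, transpose_transpose, diagonal_transpose, transpose_mul, transpose_mul, transpose_transpose, hHcs,
      Matrix.mul_assoc, Matrix.mul_assoc]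
  · simp only [star_trivial, sub_mulVec, add_mulVec, dotProduct_sub, dotProduct_add, smul_mulVec, dotProduct_smul, smul_eq_mul, sub_nonneg]
    have e1 : u ⬝ᵥ ((Qᵀ * Hc * Q) *ᵥ u) = (Q *ᵥ u) ⬝ᵥ (Hc *ᵥ (Q *ᵥ u)) := by
      rw [mulVec_dotProduct_eq, mulVec_mulVec, mulVec_mulVec, Matrix.mul_assoc]
    have e2 : u ⬝ᵥ ((Qᵀ * Matrix.diagonal (fun p : μ × o => wc * ∑ e' ∈ Finset.univ.filter (fun e' => tgt' e' = p.1), τ e' ^ 2) * Q) *ᵥ u) =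
        (Q *ᵥ u) ⬝ᵥ (Matrix.diagonal (fun p : μ × o => wc * ∑ e' ∈ Finset.univ.filter (fun e' => tgt' e' = p.1), τ e' ^ 2) *ᵥ (Q *ᵥ u)) := by
      rw [mulVec_dotProduct_eq, mulVec_mulVec, mulVec_mulVec, Matrix.mul_assoc]
    rw [e1, e2]
    refine (covJensen_transfer_weighted_of_polar hq hq1 hW hR hR' hQ hwc hHc hτ hHf hσq hx0 hxℓ hsrc htgt hT0 hT hmult hw hNdef hN hsym hκ u (hP u)
      (hΦ u) (hΦ' u) hs ht hr).trans (le_of_eq ?_)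
    ring

end Transfer

/-! ## §3 THE WEIGHTED-MASS END (PART 88 at `τ_j = 1`, `θ_m = 1`, `Λ = θ²`) -/

section Tower

variable {c : Type*} [Fintype c] [DecidableEq c]
variable {ι : ℕ → Type*} [∀ j, Fintype (ι j)] [∀ j, DecidableEq (ι j)]
variable {H : ∀ j, Matrix (ι j) (ι j) ℝ} {Qf : ∀ j, Matrix (ι j) (ι (j + 1)) ℝ} {Qc : ∀ j, Matrix c (ι j) ℝ}
variable {P : ∀ j, Matrix (ι (j + 1)) (ι j) ℝ} {G : ∀ j, Matrix (ι j) (ι j) ℝ} {e : ℕ → ℝ} {cst B E₀ W₀ θ θp : ℝ}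

/-- **`towerEnd_of_weightedMassSchedule` — PART 20's TOWER END IN WEIGHTED-MASS CURRENCY** [our proof; gan24-idea-1 g64 LENS 21].  PART 20's structural hypotheses,
(CONS) `≤ cst·θ^j`, k-uniform `|𝒮_j| ≤ B`, the family `∀ s > 0, 0 ≤ ((1+s)(1+e_j))•H_{j+1} + (1+s⁻¹)•G_{j+1} − Qf_jᵀH_jQf_j` (the carrier `G_{j+1} = Qf_jᵀ D_{τ,j} Qf_j`
of §2 — the tower mismatch INSIDE the carrier, no size hypothesis), the polar-slack schedule `0 ≤ e_j ≤ E₀θ_p^j`, and the WEIGHTED-MASS schedule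
`|(ℋ_jᵀG_jℋ_j)_{ab}| ≤ W₀·(θ²)^j` (`0 < θ ≤ 1`, `0 ≤ θ_p ≤ θ`, `0 ≤ E₀, W₀`) ⟹ `|𝒮_{j+1}(a,b) − 𝒮_j(a,b)| ≤ (cst + 2(1 + 2E₀)B + 4W₀θ²)·θ^j` — no `Λ`,
no `θ_m`, no `hrate`. -/
theorem towerEnd_of_weightedMassSchedule (hH : ∀ j, (H j).PosSemidef) (hk : ∀ j, IsUnit (kkt (H j) (Qc j)).det)
    (hcomp : ∀ j, Qc (j + 1) = Qc j * Qf j) (hPQ : ∀ j, Qc (j + 1) * P j = Qc j) (hG : ∀ j, (G j)ᵀ = G j)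
    (hstab : ∀ j (s : ℝ), 0 < s →
      ((((1 + s) * (1 + e j)) • H (j + 1) + (1 + s⁻¹) • G (j + 1) - (Qf j)ᵀ * H j * Qf j).PosSemidef))
    (hcons : ∀ j (y : c), (minOp (H j) (Qc j) *ᵥ Pi.single y 1) ⬝ᵥ
        (((P j)ᵀ * H (j + 1) * P j - H j) *ᵥ (minOp (H j) (Qc j) *ᵥ Pi.single y 1)) ≤ cst * θ ^ j)
    (hB : ∀ j a b, |effForm (H j) (Qc j) a b| ≤ B)
    (he : ∀ j, 0 ≤ e j ∧ e j ≤ E₀ * θp ^ j)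
    (hW : ∀ j a b, |((minOp (H j) (Qc j))ᵀ * G j * minOp (H j) (Qc j)) a b| ≤ W₀ * (θ ^ 2) ^ j)
    (hθ : 0 < θ) (hθ1 : θ ≤ 1) (hθp : 0 ≤ θp) (hθpθ : θp ≤ θ) (hE₀ : 0 ≤ E₀) (hW₀ : 0 ≤ W₀) :
    ∀ j (a b : c), |effForm (H (j + 1)) (Qc (j + 1)) a b - effForm (H j) (Qc j) a b| ≤
      (cst + 2 * (1 + 2 * E₀) * B + 4 * (W₀ * θ ^ 2)) * θ ^ j := by
  have h := towerEnd_of_stabFamily_of_schedules (τ := fun _ => (1 : ℝ)) (M₀ := 1) (θm := 1) (Λ := θ ^ 2) (N₀ := W₀)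
    hH hk hcomp hPQ hG (fun j s hs => by simpa only [one_pow, mul_one] using hstab j s hs) hcons hB he
    (fun j => ⟨zero_le_one, by rw [one_pow, mul_one]⟩) hW hθ hθ1 hθp hθpθ hE₀ hW₀ (sq_nonneg θ) (by rw [one_pow, one_mul])
  simpa only [one_pow, one_mul] using h

/-- **`exists_effForm_limit_of_weightedMassSchedule` — THE LIMIT FORM IN WEIGHTED-MASS CURRENCY** [our proof]: under the same hypotheses and `θ < 1`:
`∃ 𝒮_∞`, `𝒮_j(a,b) → 𝒮_∞(a,b)`, `|𝒮_j(a,b) − 𝒮_∞(a,b)| ≤ (cst + 2(1 + 2E₀)B + 4W₀θ²)·θ^j∕(1 − θ)`. -/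
theorem exists_effForm_limit_of_weightedMassSchedule (hH : ∀ j, (H j).PosSemidef) (hk : ∀ j, IsUnit (kkt (H j) (Qc j)).det)
    (hcomp : ∀ j, Qc (j + 1) = Qc j * Qf j) (hPQ : ∀ j, Qc (j + 1) * P j = Qc j) (hG : ∀ j, (G j)ᵀ = G j)
    (hstab : ∀ j (s : ℝ), 0 < s →
      ((((1 + s) * (1 + e j)) • H (j + 1) + (1 + s⁻¹) • G (j + 1) - (Qf j)ᵀ * H j * Qf j).PosSemidef))
    (hcons : ∀ j (y : c), (minOp (H j) (Qc j) *ᵥ Pi.single y 1) ⬝ᵥ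
        (((P j)ᵀ * H (j + 1) * P j - H j) *ᵥ (minOp (H j) (Qc j) *ᵥ Pi.single y 1)) ≤ cst * θ ^ j)
    (hB : ∀ j a b, |effForm (H j) (Qc j) a b| ≤ B)
    (he : ∀ j, 0 ≤ e j ∧ e j ≤ E₀ * θp ^ j)
    (hW : ∀ j a b, |((minOp (H j) (Qc j))ᵀ * G j * minOp (H j) (Qc j)) a b| ≤ W₀ * (θ ^ 2) ^ j)
    (hθ : 0 < θ) (hθ1 : θ < 1) (hθp : 0 ≤ θp) (hθpθ : θp ≤ θ) (hE₀ : 0 ≤ E₀) (hW₀ : 0 ≤ W₀) :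
    ∃ Sinf : Matrix c c ℝ, ∀ a b : c, Tendsto (fun j => effForm (H j) (Qc j) a b) atTop (𝓝 (Sinf a b)) ∧
      ∀ j, |effForm (H j) (Qc j) a b - Sinf a b| ≤ (cst + 2 * (1 + 2 * E₀) * B + 4 * (W₀ * θ ^ 2)) * θ ^ j / (1 - θ) := by
  have h := exists_effForm_limit_of_stabFamily_of_schedules (τ := fun _ => (1 : ℝ)) (M₀ := 1) (θm := 1) (Λ := θ ^ 2) (N₀ := W₀)
    hH hk hcomp hPQ hG (fun j s hs => by simpa only [one_pow, mul_one] using hstab j s hs) hcons hB he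
    (fun j => ⟨zero_le_one, by rw [one_pow, mul_one]⟩) hW hθ hθ1 hθp hθpθ hE₀ hW₀ (sq_nonneg θ) (by rw [one_pow, one_mul])
  simpa only [one_pow, one_mul] using h

/-! ### §4 The weighted-mass END fed literally by §2's `(s,t,r)`-family and a holonomy schedule -/

variable {κ : ℕ → ℝ} {K₀ ϖ ϖ' : ℝ}

/-- **`towerEnd_of_plaquetteSchedule_of_weightedMassSchedule` — §3 FED LITERALLY BY §2's FAMILY** [our proof]: the family
`∀ s t r > 0, 0 ≤ ((1+s)(1 + t + (1+t⁻¹)(1+r)ϖκ_j² + (1+t⁻¹)(1+r⁻¹)(3κ_j²∕(4−κ_j²))(1+ϖ+ϖ′)))•H_{j+1} + (1+s⁻¹)•G_{j+1} − Qf_jᵀH_jQf_j`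
(`posSemidef_covJensen_transfer_weighted_of_polar`'s shape, `G_{j+1} = Qf_jᵀD_{τ,j}Qf_j`), the HOLONOMY schedule `0 ≤ κ_j ≤ K₀θ_p^j` (`0 < K₀ ≤ 1`), the
WEIGHTED-MASS schedule `|(ℋ_jᵀG_jℋ_j)_{ab}| ≤ W₀(θ²)^j`, `0 < θ_p ≤ θ ≤ 1`, `0 ≤ ϖ, ϖ′, W₀` ⟹
`|𝒮_{j+1}(a,b) − 𝒮_j(a,b)| ≤ (cst + 2(1 + 2(5 + 8ϖ + 4ϖ′)K₀)B + 4W₀θ²)·θ^j` (choices `t_j = K₀θ_p^j`, `r = 1`, `s_j = θ^j`). -/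
theorem towerEnd_of_plaquetteSchedule_of_weightedMassSchedule (hH : ∀ j, (H j).PosSemidef) (hk : ∀ j, IsUnit (kkt (H j) (Qc j)).det)
    (hcomp : ∀ j, Qc (j + 1) = Qc j * Qf j) (hPQ : ∀ j, Qc (j + 1) * P j = Qc j) (hG : ∀ j, (G j)ᵀ = G j)
    (hstab : ∀ j (s t r : ℝ), 0 < s → 0 < t → 0 < r →
      ((((1 + s) * (1 + t + (1 + t⁻¹) * (1 + r) * ϖ * κ j ^ 2 + (1 + t⁻¹) * (1 + r⁻¹) * (3 * κ j ^ 2 / (4 - κ j ^ 2)) * (1 + ϖ + ϖ'))) •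
          H (j + 1) + (1 + s⁻¹) • G (j + 1) - (Qf j)ᵀ * H j * Qf j).PosSemidef))
    (hcons : ∀ j (y : c), (minOp (H j) (Qc j) *ᵥ Pi.single y 1) ⬝ᵥ
        (((P j)ᵀ * H (j + 1) * P j - H j) *ᵥ (minOp (H j) (Qc j) *ᵥ Pi.single y 1)) ≤ cst * θ ^ j)
    (hB : ∀ j a b, |effForm (H j) (Qc j) a b| ≤ B)
    (hκ : ∀ j, 0 ≤ κ j ∧ κ j ≤ K₀ * θp ^ j) (hK₀ : 0 < K₀) (hK₀1 : K₀ ≤ 1)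
    (hW : ∀ j a b, |((minOp (H j) (Qc j))ᵀ * G j * minOp (H j) (Qc j)) a b| ≤ W₀ * (θ ^ 2) ^ j)
    (hϖ : 0 ≤ ϖ) (hϖ' : 0 ≤ ϖ') (hθ : 0 < θ) (hθ1 : θ ≤ 1) (hθp : 0 < θp) (hθpθ : θp ≤ θ) (hW₀ : 0 ≤ W₀) :
    ∀ j (a b : c), |effForm (H (j + 1)) (Qc (j + 1)) a b - effForm (H j) (Qc j) a b| ≤
      (cst + 2 * (1 + 2 * ((5 + 8 * ϖ + 4 * ϖ') * K₀)) * B + 4 * (W₀ * θ ^ 2)) * θ ^ j := by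
  have ht : ∀ j, 0 < K₀ * θp ^ j := fun j => mul_pos hK₀ (pow_pos hθp j)
  have ht1 : ∀ j, K₀ * θp ^ j ≤ 1 := fun j =>
    (mul_le_mul_of_nonneg_left (pow_le_one₀ hθp.le (hθpθ.trans hθ1)) hK₀.le).trans (by rw [mul_one]; exact hK₀1)
  refine towerEnd_of_weightedMassSchedule (E₀ := (5 + 8 * ϖ + 4 * ϖ') * K₀) (θp := θp)
    (e := fun j => (1 + K₀ * θp ^ j + (1 + (K₀ * θp ^ j)⁻¹) * (1 + 1) * ϖ * κ j ^ 2 +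
      (1 + (K₀ * θp ^ j)⁻¹) * (1 + (1 : ℝ)⁻¹) * (3 * κ j ^ 2 / (4 - κ j ^ 2)) * (1 + ϖ + ϖ')) - 1)
    hH hk hcomp hPQ hG (fun j s hs => ?_) hcons hB (fun j => ⟨?_, ?_⟩) hW hθ hθ1 hθp.le hθpθ (by positivity) hW₀
  · have h := hstab j s (K₀ * θp ^ j) 1 hs (ht j) one_pos
    have e1 : (1 + (1 + K₀ * θp ^ j + (1 + (K₀ * θp ^ j)⁻¹) * (1 + 1) * ϖ * κ j ^ 2 +
        (1 + (K₀ * θp ^ j)⁻¹) * (1 + (1 : ℝ)⁻¹) * (3 * κ j ^ 2 / (4 - κ j ^ 2)) * (1 + ϖ + ϖ') - 1)) =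
        1 + K₀ * θp ^ j + (1 + (K₀ * θp ^ j)⁻¹) * (1 + 1) * ϖ * κ j ^ 2 +
          (1 + (K₀ * θp ^ j)⁻¹) * (1 + (1 : ℝ)⁻¹) * (3 * κ j ^ 2 / (4 - κ j ^ 2)) * (1 + ϖ + ϖ') := by ring
    rw [e1]; exact h
  · exact polarCoeff_sub_one_nonneg hϖ hϖ' (ht j) (hκ j).1 ((hκ j).2.trans (ht1 j))
  · exact (polarCoeff_sub_one_le hϖ hϖ' (ht j) (ht1 j) (hκ j).1 (hκ j).2).trans_eq (mul_assoc _ _ _).symm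

end Tower

end Summit.QuantumFields.BalabanUV.Beta.GAN24.DerivativeRateTransferJensenMassFreeTransferWeighted

end
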